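import Mathlib
import HarnessLib
import Summits.CriticalPhenomena.PercolationContinuityZ3.Theses.PercTreeValue
import Literature.Probability.Percolation.BlockResampling
import Literature.Probability.Percolation.InfiniteClusterDensity
import Literature.Probability.Percolation.TwoPointFunction
import Literature.Probability.Percolation.PercolationEvents
import Literature.Probability.Percolation.CriticalContinuityProofs
import Summits.CriticalPhenomena.PercolationContinuityZ3.Theorems.PercTreeValueTetrahedronHarrisGapStubNoiseHarris
import Summits.CriticalPhenomena.PercolationContinuityZ3.Theorems.PercTreeValueTetrahedronHarrisGapStubNoiseStability
import Summits.CriticalPhenomena.PercolationContinuityZ3.Theorems.PercTreeValueTetrahedronHarrisGapStubNoiseWindow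

/-!
# Line `noise_bridges` (ALTERNATIVE line, crux-strategist s3) for crux `TetrahedronHarrisGap`
(stmt-CriticalPhenomena-7799), route `PercTreeValue`

Strategist planner-cstrat-stmt-CriticalPhenomena-7799-s3-0, 2026-08-17.  UPDATE (lead c3, cycle 2, 2026-08-17T17:10Z): the three PROVABLE
stubs N/D/T are LANDED (`stub_noiseHarris` p169207, `stub_noiseWindow` p169734 with p169286/p169632, `stub_noiseStability` p169691) and linked
below; the remaining `sorry`s are the two 3-D content stubs S1 `stub_bridgeMass`, S2 `stub_bridgeFragility`.  This skeleton is registered NEXT TO the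
live line `Lines/SketchIdeator1.lean` (corner-ball total covariance, lead c2); it does not touch it.  Card:
`Lines/noise_bridges.md`; census: `STRATEGY-CENSUS.md` (both in this crux directory).  Origin: crux idea
`Ideas/noise-interpolation-crossed-bridges.md` (ideator 1, never planned), re-cut in the ADDITIVE (covariance) form so that
the composition is pure real arithmetic and no `exp`/`log`/pairing bound is needed.

Crux (by name): `∃ δ > 0, ∃ r₀, ∀ r ≥ r₀, (1+δ) τ(0,a_r) τ(b_r,c_r) ≤ P_{p_c}(0 ↔ a_r ∧ b_r ↔ c_r)`,
`a_r = (r,r,0)`, `b_r = (r,0,r)`, `c_r = (0,r,r)`; write `A = {0 ↔ a_r}`, `B = {b_r ↔ c_r}`, `P = P_{p_c(ℤ³)}`.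

## The mechanism (exact noise interpolation inside a finite window)

Fix the finite WINDOW `W_r = armEdges (2r) 0` (lattice edges touching `B(0,2r) ⊇ T_r`).  For `t ∈ [0,1]` let
`M ∼ P_t` be an independent Bernoulli-`t` edge set (the tree's `bondPercolation (zdGraph 3) t`) and `ω' ∼ P` an
independent copy; the NOISED configuration is `ω_t := resample (M ∩ W_r) (ω, ω')` (tree `resample`: `ω` off `M ∩ W_r`,
`ω'` on it).  Put `φ_r(t) := (P ⊗ P ⊗ P_t){ω ∈ A, ω_t ∈ B}` and the CO-PIVOTAL COUNT
`C_r(t) := Σ_{e ∈ W_r} (P ⊗ P ⊗ P_t){e ∈ Piv_A(ω), e ∈ Piv_B(ω_t)}`.  Three PROVABLE facts (stubs N, D, T):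

* N `stub_noiseHarris`   — `φ_r(t) ≥ τ_A τ_B` for every `t` (for fixed `M`, `E[1_A(ω) 1_B(ω_t)] = ∫ f_K g_K dP ≥ ∫ f_K ∫ g_K`
  with `f_K = P(A | ω off K)`, `K = M ∩ W_r`: Harris for the increasing bulk functionals; Fubini over `M`).
* D `stub_noiseWindow`   — `P(A ∩ B) − φ_r(t) = p_c(1−p_c) ∫₀ᵗ C_r(s) ds` (`φ_r` is a polynomial in `t`; its derivative is
  the Margulis–Russo sum over `f ∈ W_r` of the one-bit covariance `p(1-p)·1{f ∈ Piv_A(ω)}·1{f ∈ Piv_B(ω_s)}`), stated in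
  the integrated form the composition consumes: `C_r ≥ m` on `[0,t]` ⟹ `κ t m ≤ P(A∩B) − φ_r(t)`, `κ = p_c(1−p_c) > 0`
  (`criticalProb_zd_pos`, `criticalProb_zd_lt_one`).  This is the Kalai–Keller–Mossel / Radhakrishnan–Tassion identity
  (arXiv:1511.04600 Lemma "noise decreases correlation"; arXiv:2410.23250 Prop. 1) cut at the window instead of `[0,1]`.
* T `stub_noiseStability` — `J_r − C_r(s) ≤ s · F_r`, where `J_r := Σ_e P(e ∈ Piv_A ∩ Piv_B)` (= `C_r(0)`) and
  `F_r := Σ_{e,f ∈ W_r} P(f pivotal for the event {e ∈ Piv_A ∩ Piv_B})` is the total FRAGILITY of the co-pivotality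
  indicators: hybrid argument along an enumeration of `W_r` (each hybrid is a fair sample, `map_resample_prod`; the mask
  coordinate `1{f ∈ M}` is independent of the earlier hybrid; union bound).

and two 3-D CONTENT stubs, both first-moment statements about ONE configuration (`ν_r := Σ_{e∈W_r} P(e ∈ Piv_A)`, the
Russo quantity `= E[N_A]`, so `ν_r/τ_A ≍ E[N_A | A]`):

* S1 `stub_bridgeMass`      — `J_r ≥ c₁ ν_r τ_B` (and `ν_r ≥ τ_A`): a uniformly positive fraction of the pivotal edges of
  `{0↔a_r}` are ALSO pivotal for `{b_r↔c_r}`, at the independent rate.  By ideator 1's F3 (tetrahedral symmetry) a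
  co-pivotal edge is exactly a kissing edge of the CROSSED disjoint coexistence `D₂ ∪ D₃` of `ω ∖ e`, so
  `J_r = E[K_× ; D₂ ∪ D₃]/(1−p_c)`: S1 is the kissing-mass form of the rank-2 crux's event (reverse-BK class) — see the card.
  MC (ideator 1, kit j016896–8, j017097–8): crossed bridges are 22–25 % of all open pivotals given a bridge, `q₁ ≈ 0.3`, flat
  in `r ≤ 24`.
* S2 `stub_bridgeFragility` — `τ_A F_r ≤ C₂ ν_r J_r`: the mean fragility of a co-pivotal edge (edges whose flip destroys or
  creates its co-pivotality: the other pivotals of `A`, `B` and the closed "kissing" edges joining the two sides) is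
  `O(E[N_A | A])`, i.e. no anomalous concentration of pivotals on bridge configurations.  MC: kissing number `K_e ≈ 2.5 N_piv`
  flat for `r = 4…16` (`≈ (1−p_c)/p_c = 3.0`, closed vs open pivotals).

## Composition (KERNEL-CHECKED below, `TetrahedronHarrisGap_of`; pure real arithmetic `harrisGap_of_noiseData`)

For `r ≥ max r₀`: `C := max C₂ 1`, `t₀ := τ_A/(2 C ν_r) ∈ (0, 1/2]`.  For `s ≤ t₀`: `C_r(s) ≥ J_r − s F_r ≥ J_r − t₀ F_r ≥ J_r/2`
(T, S2).  D with `m = J_r/2`: `P(A∩B) − φ_r(t₀) ≥ κ t₀ J_r/2 = κ τ_A J_r/(4 C ν_r) ≥ κ c₁ τ_A τ_B/(4C)` (S1).  N: `φ_r(t₀) ≥ τ_Aτ_B`.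
Hence the crux with `δ = κ c₁ /(4 max(C₂,1))`.  (If `τ_A = 0` the inequality is trivial.)

## Why it dodges the STUCK goal of the live line

The live line keeps, in the total-covariance split `Cov(A,B) = E[Cov(A,B | off K)] + Cov(f_K, g_K)` over the corner block
`K_r`, the BULK term `Cov(f_K,g_K)` and is stuck on its positivity (`stub_coherence`: "every covariance lower bound is a
revealment bound; one edge last is polynomially short", dossier §R6.2) next to `stub_annulusNonCrossing` = stmt-0846.
This line keeps the OTHER term for a RANDOM SPARSE block `M ∩ W_r` of density `t₀ ≍ 1/E[N_A|A]`: not one edge last but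
`≍ 1` pivotal edge last, which by D collects `t₀ · J_r ≍ ττ` — the exact answer to §R6.2 (i).  No RSW blocking, no stmt-0846,
no positive-association statement; the 3-D inputs are pivotal-COUNT statements (S1 reverse-BK-type, S2 regularity).

Disproof.lean: none exists for this crux (`ledger crux ls`, 2026-08-17).  Negatives index: no pivotal/noise statement refuted.
-/

noncomputable section

open MeasureTheory Filter Set
open Literature.Probability.Percolation Literature.Probability.LatticeModels

namespace Summit.CriticalPhenomena.PercolationContinuityZ3.Cruxes.TetrahedronHarrisGap.NoiseBridges

/-! ## Registered stubs (DEF-FREE over tree declarations)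

Abbreviations used in the docstrings only: `P = bondPercolation (zdGraph 3) (criticalProbI 3)`, `P_t = bondPercolation (zdGraph 3) t`,
`A = openConn 0 ![r,r,0]`, `B = openConn ![r,0,r] ![0,r,r]`, `W = armEdges (2*r) 0`, for `x = (ω, ω', M)`:
`ω_t = resample (M ∩ W) (ω, ω')`, `φ(t) = (P ⊗ P ⊗ P_t){ω ∈ A ∧ ω_t ∈ B}`,
`C(s) = Σ_{e∈W} (P ⊗ P ⊗ P_s){e ∈ Piv_A ω ∧ e ∈ Piv_B ω_s}`, `J = Σ_{e∈W} P{e ∈ Piv_A ∧ e ∈ Piv_B}`,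
`ν = Σ_{e∈W} P{e ∈ Piv_A}`, `F = Σ_{e,f∈W} P{f ∈ Piv({η | e ∈ Piv_A η ∧ e ∈ Piv_B η})}` (`IsPivotal` = XOR-pivotality). -/

/-- **stub_noiseHarris — LANDED (p169207, worker of lead c3, `Theorems/PercTreeValueTetrahedronHarrisGapStubNoiseHarris.lean`)** — noise keeps the Harris sign: for every noise level `t`,
`(P ⊗ P ⊗ P_t){ω ∈ A, ω_t ∈ B} ≥ τ(0,a_r) τ(b_r,c_r)`.  Proof route: for a fixed finite `K`,
`(P⊗P){ω ∈ A, resample K (ω,ω') ∈ B} = ∫ 1_A · blockCondProb K B dP ≥ P(A) · P(B)` (Harris for the increasing functions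
`1_A`, `P(B | ω off K)`; `integral_blockCondProb_eq`), then Fubini over `M` (`K = M ∩ W`).  [KKM arXiv:1511.04600] -/
theorem stub_noiseHarris :
    ∀ (r : ℕ) (t : unitInterval),
      tau 3 (criticalProbI 3) 0 ![(r : ℤ), (r : ℤ), 0] * tau 3 (criticalProbI 3) ![(r : ℤ), 0, (r : ℤ)] ![0, (r : ℤ), (r : ℤ)] ≤
        ((bondPercolation (zdGraph 3) (criticalProbI 3)).prod ((bondPercolation (zdGraph 3) (criticalProbI 3)).prod (bondPercolation (zdGraph 3) t))).real {x : BondConfig (Site 3) × (BondConfig (Site 3) × BondConfig (Site 3)) | x.1 ∈ openConn (0 : Site 3) ![(r : ℤ), (r : ℤ), 0] ∧ resample (x.2.2 ∩ (↑(armEdges (2 * r) (0 : Site 3)) : Set (Sym2 (Site 3)))) (x.1, x.2.1) ∈ openConn ![(r : ℤ), 0, (r : ℤ)] ![0, (r : ℤ), (r : ℤ)]} :=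
  Summit.CriticalPhenomena.PercolationContinuityZ3.Theorems.TetrahedronHarrisGap.stub_noiseHarris

/-- **stub_noiseWindow — LANDED (p169734 + infrastructure p169286/p169632, lead c3, `Theorems/PercTreeValueTetrahedronHarrisGapStubNoiseWindow{Expansion,OneBit,}.lean`)** — the exact noise-derivative formula, integrated over a window:
`P(A∩B) − φ(t) = p_c(1-p_c) ∫₀ᵗ C(s) ds`, hence `C ≥ m` on `[0,t]` gives `κ·t·m ≤ P(A∩B) − φ(t)` with `κ = p_c(1−p_c) > 0`.
`φ` is a polynomial in `t` (expand over `K = M ∩ W ⊆ W`, weights `t^|K| (1-t)^{|W|-|K|}`); Margulis–Russo in `t` and the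
one-bit covariance `ψ(K) − ψ(K ∪ f) = p(1-p)·(P⊗P){f ∈ Piv_A ω ∧ f ∈ Piv_B (resample K (ω,ω'))}` (pivotality of `f` does not
depend on the bit at `f`, `isPivotal_insert_iff`).  [Radhakrishnan–Tassion arXiv:2410.23250 Prop. 1; KKM arXiv:1511.04600] -/
theorem stub_noiseWindow :
    ∃ κ : ℝ, 0 < κ ∧ ∀ (r : ℕ) (t : unitInterval) (m : ℝ),
      (∀ s : unitInterval, s ≤ t → m ≤
        ∑ e ∈ armEdges (2 * r) (0 : Site 3), ((bondPercolation (zdGraph 3) (criticalProbI 3)).prod ((bondPercolation (zdGraph 3) (criticalProbI 3)).prod (bondPercolation (zdGraph 3) s))).real {x : BondConfig (Site 3) × (BondConfig (Site 3) × BondConfig (Site 3)) | IsPivotal (openConn (0 : Site 3) ![(r : ℤ), (r : ℤ), 0]) e x.1 ∧ IsPivotal (openConn ![(r : ℤ), 0, (r : ℤ)] ![0, (r : ℤ), (r : ℤ)]) e (resample (x.2.2 ∩ (↑(armEdges (2 * r) (0 : Site 3)) : Set (Sym2 (Site 3)))) (x.1, x.2.1))}) →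
      κ * (t : ℝ) * m ≤
        (bondPercolation (zdGraph 3) (criticalProbI 3)).real (openConn 0 ![(r : ℤ), (r : ℤ), 0] ∩ openConn ![(r : ℤ), 0, (r : ℤ)] ![0, (r : ℤ), (r : ℤ)]) -
        ((bondPercolation (zdGraph 3) (criticalProbI 3)).prod ((bondPercolation (zdGraph 3) (criticalProbI 3)).prod (bondPercolation (zdGraph 3) t))).real {x : BondConfig (Site 3) × (BondConfig (Site 3) × BondConfig (Site 3)) | x.1 ∈ openConn (0 : Site 3) ![(r : ℤ), (r : ℤ), 0] ∧ resample (x.2.2 ∩ (↑(armEdges (2 * r) (0 : Site 3)) : Set (Sym2 (Site 3)))) (x.1, x.2.1) ∈ openConn ![(r : ℤ), 0, (r : ℤ)] ![0, (r : ℤ), (r : ℤ)]} :=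
  Summit.CriticalPhenomena.PercolationContinuityZ3.Theorems.TetrahedronHarrisGap.stub_noiseWindow

/-- **stub_noiseStability — LANDED (p169691, worker of lead c3, `Theorems/PercTreeValueTetrahedronHarrisGapStubNoiseStability.lean`)** — union bound along the resampling path:
`J − C(s) ≤ Σ_e (P⊗P⊗P_s){g_e(ω) ∧ ¬ g_e(ω_s)} ≤ s · F`, `g_e = {e ∈ Piv_A ∩ Piv_B}`: enumerate `W = {f₁,…,f_n}`, hybrids
`ω_j = resample (M ∩ {f₁..f_j}) (ω,ω')` are fair samples (`map_resample_prod`), `{g(ω_j) ≠ g(ω_{j+1})} ⊆ {f_{j+1} ∈ M} ∩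
{f_{j+1} ∈ Piv_g ω_j}` and `1{f_{j+1} ∈ M}` is independent of `ω_j` (product structure of `P_s`), cf. the hybrid chain
`setOf_mem_and_resample_notMem_subset` of BlockResampling.lean.  [Schramm–Smirnov 2011 §2; folklore] -/
theorem stub_noiseStability :
    ∀ (r : ℕ) (s : unitInterval),
      (∑ e ∈ armEdges (2 * r) (0 : Site 3), (bondPercolation (zdGraph 3) (criticalProbI 3)).real {ω : BondConfig (Site 3) | IsPivotal (openConn (0 : Site 3) ![(r : ℤ), (r : ℤ), 0]) e ω ∧ IsPivotal (openConn ![(r : ℤ), 0, (r : ℤ)] ![0, (r : ℤ), (r : ℤ)]) e ω}) -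
        (∑ e ∈ armEdges (2 * r) (0 : Site 3), ((bondPercolation (zdGraph 3) (criticalProbI 3)).prod ((bondPercolation (zdGraph 3) (criticalProbI 3)).prod (bondPercolation (zdGraph 3) s))).real {x : BondConfig (Site 3) × (BondConfig (Site 3) × BondConfig (Site 3)) | IsPivotal (openConn (0 : Site 3) ![(r : ℤ), (r : ℤ), 0]) e x.1 ∧ IsPivotal (openConn ![(r : ℤ), 0, (r : ℤ)] ![0, (r : ℤ), (r : ℤ)]) e (resample (x.2.2 ∩ (↑(armEdges (2 * r) (0 : Site 3)) : Set (Sym2 (Site 3)))) (x.1, x.2.1))}) ≤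
      (s : ℝ) * (∑ e ∈ armEdges (2 * r) (0 : Site 3), ∑ f ∈ armEdges (2 * r) (0 : Site 3), (bondPercolation (zdGraph 3) (criticalProbI 3)).real {ω : BondConfig (Site 3) | IsPivotal {η : BondConfig (Site 3) | IsPivotal (openConn (0 : Site 3) ![(r : ℤ), (r : ℤ), 0]) e η ∧ IsPivotal (openConn ![(r : ℤ), 0, (r : ℤ)] ![0, (r : ℤ), (r : ℤ)]) e η} f ω}) :=
  Summit.CriticalPhenomena.PercolationContinuityZ3.Theorems.TetrahedronHarrisGap.stub_noiseStability

/-- **stub_bridgeMass (S1; OPEN — 3-D content, reverse-BK class)** — crossed-bridge (co-pivotal) mass at the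
independent rate: `Σ_{e∈W} P(e ∈ Piv_A ∩ Piv_B) ≥ c₁ · (Σ_{e∈W} P(e ∈ Piv_A)) · τ(b_r,c_r)` for `r ≥ r₀`, together with the
harmless normalisation `Σ_e P(e ∈ Piv_A) ≥ τ(0,a_r)` (at least one pivotal window edge per connection on average).
Equivalently (tetrahedral symmetry, ideator 1 F3): `E[K_× ; D₂ ∪ D₃] ≥ c₁(1−p_c) ν τ_B`, the kissing mass of CROSSED disjoint
coexistence — fails in every jump world / above six dimensions as it must.  MC: bridge fraction 0.22–0.25, `q₁ ≈ 0.3` flat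
(kit j016896–8).  Why it might fail: it is a lower bound on a disjoint-occurrence-type quantity (no tool in `d = 3`); if the
rank-2 amplitude `d_r → 0` while kissing numbers stay `≍ N`, S1 is false. [Harris1960; GPS arXiv:1008.1378 (2-D pivotal measure);
Kesten1987Scaling] -/
theorem stub_bridgeMass :
    ∃ c₁ : ℝ, 0 < c₁ ∧ ∃ r₀ : ℕ, ∀ r : ℕ, r₀ ≤ r →
      c₁ * (∑ e ∈ armEdges (2 * r) (0 : Site 3), (bondPercolation (zdGraph 3) (criticalProbI 3)).real {ω : BondConfig (Site 3) | IsPivotal (openConn (0 : Site 3) ![(r : ℤ), (r : ℤ), 0]) e ω}) * tau 3 (criticalProbI 3) ![(r : ℤ), 0, (r : ℤ)] ![0, (r : ℤ), (r : ℤ)] ≤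
        (∑ e ∈ armEdges (2 * r) (0 : Site 3), (bondPercolation (zdGraph 3) (criticalProbI 3)).real {ω : BondConfig (Site 3) | IsPivotal (openConn (0 : Site 3) ![(r : ℤ), (r : ℤ), 0]) e ω ∧ IsPivotal (openConn ![(r : ℤ), 0, (r : ℤ)] ![0, (r : ℤ), (r : ℤ)]) e ω}) ∧
      tau 3 (criticalProbI 3) 0 ![(r : ℤ), (r : ℤ), 0] ≤ ∑ e ∈ armEdges (2 * r) (0 : Site 3), (bondPercolation (zdGraph 3) (criticalProbI 3)).real {ω : BondConfig (Site 3) | IsPivotal (openConn (0 : Site 3) ![(r : ℤ), (r : ℤ), 0]) e ω} := by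
  sorry

/-- **stub_bridgeFragility (S2; OPEN — 3-D regularity)** — mean fragility of a co-pivotal edge is `O(E[N_A | A])`:
`τ(0,a_r) · F ≤ C₂ · ν · J` for `r ≥ r₀`, `F = Σ_{e,f} P(f ∈ Piv{e co-pivotal})`.  The edges `f` that flip the co-pivotality of
`e` are the other pivotals of `A`/`B` and the closed edges joining the two sides of the bridge (= closed pivotals of the
re-connection), so S2 says pivotal counts do not concentrate anomalously on bridge configurations (a second-moment-type
regularity; trivial bound is `|W| ≍ r³` in place of `ν/τ_A ≍ r^{0.86}`).  MC: kissing number `≈ 2.5 N_piv`, flat `r = 4…16`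
(kit j017097–8).  Why it might fail: two disjoint critical clusters that touch once might touch `≍ r^{2d_f−3} ≫ N` times
(free interpenetration) — the MC says they do not, a proof needs arm-separation-type input. [TassionVanneuville arXiv:2011.04572
(2-D stability); GPS arXiv:1008.1378] -/
theorem stub_bridgeFragility :
    ∃ C₂ : ℝ, 0 < C₂ ∧ ∃ r₀ : ℕ, ∀ r : ℕ, r₀ ≤ r →
      tau 3 (criticalProbI 3) 0 ![(r : ℤ), (r : ℤ), 0] * (∑ e ∈ armEdges (2 * r) (0 : Site 3), ∑ f ∈ armEdges (2 * r) (0 : Site 3), (bondPercolation (zdGraph 3) (criticalProbI 3)).real {ω : BondConfig (Site 3) | IsPivotal {η : BondConfig (Site 3) | IsPivotal (openConn (0 : Site 3) ![(r : ℤ), (r : ℤ), 0]) e η ∧ IsPivotal (openConn ![(r : ℤ), 0, (r : ℤ)] ![0, (r : ℤ), (r : ℤ)]) e η} f ω}) ≤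
        C₂ * (∑ e ∈ armEdges (2 * r) (0 : Site 3), (bondPercolation (zdGraph 3) (criticalProbI 3)).real {ω : BondConfig (Site 3) | IsPivotal (openConn (0 : Site 3) ![(r : ℤ), (r : ℤ), 0]) e ω}) * (∑ e ∈ armEdges (2 * r) (0 : Site 3), (bondPercolation (zdGraph 3) (criticalProbI 3)).real {ω : BondConfig (Site 3) | IsPivotal (openConn (0 : Site 3) ![(r : ℤ), (r : ℤ), 0]) e ω ∧ IsPivotal (openConn ![(r : ℤ), 0, (r : ℤ)] ![0, (r : ℤ), (r : ℤ)]) e ω}) := by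
  sorry

/-! ## Composition: pure real arithmetic, then the crux BY NAME -/

/-- The real-number heart of the composition (no percolation): noise-Harris `hN`, window formula `hD`, stability `hT`,
bridge mass `h1`/`h1'`, fragility `h2` give the strict Harris gap with `δ = κ c₁ / (4 max(C₂,1))`. [this line] -/
theorem harrisGap_of_noiseData {τA τB PAB ν J F κ c₁ C₂ : ℝ} {φ C : unitInterval → ℝ}
    (hκ : 0 < κ) (hc₁ : 0 < c₁) (hC₂ : 0 < C₂)
    (hN : ∀ t : unitInterval, τA * τB ≤ φ t)
    (hD : ∀ (t : unitInterval) (m : ℝ), (∀ s : unitInterval, s ≤ t → m ≤ C s) → κ * (t : ℝ) * m ≤ PAB - φ t)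
    (hT : ∀ s : unitInterval, J - C s ≤ (s : ℝ) * F)
    (h1 : c₁ * ν * τB ≤ J) (h1' : τA ≤ ν) (h2 : τA * F ≤ C₂ * ν * J)
    (hF : 0 ≤ F) (hτA : 0 ≤ τA) (hτB : 0 ≤ τB) (hPAB : 0 ≤ PAB) :
    (1 + κ * c₁ / (4 * max C₂ 1)) * τA * τB ≤ PAB := by
  set Cm := max C₂ 1 with hCdef
  have hC1 : 1 ≤ Cm := le_max_right _ _
  have hC2 : C₂ ≤ Cm := le_max_left _ _
  have hCpos : 0 < Cm := lt_of_lt_of_le one_pos hC1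
  rcases hτA.eq_or_lt with hτ0 | hτpos
  · -- τ_A = 0: trivial
    have : (1 + κ * c₁ / (4 * Cm)) * τA * τB = 0 := by rw [← hτ0]; ring
    rw [this]; exact hPAB
  have hν : 0 < ν := lt_of_lt_of_le hτpos h1'
  have hJ : 0 ≤ J := le_trans (by positivity) h1
  -- the noise window
  set t₀ : ℝ := τA / (2 * Cm * ν) with ht₀
  have ht₀pos : 0 < t₀ := by positivity
  have ht₀le : t₀ ≤ 1 := by
    rw [ht₀, div_le_one (by positivity)]
    nlinarith
  let tI : unitInterval := ⟨t₀, ht₀pos.le, ht₀le⟩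
  -- stability inside the window: C(s) ≥ J/2 for s ≤ t₀
  have ht₀F : t₀ * F ≤ J / 2 := by
    have e1 : t₀ * F = τA * F / (2 * Cm * ν) := by rw [ht₀]; ring
    rw [e1, div_le_iff₀ (by positivity)]
    calc τA * F ≤ C₂ * ν * J := h2
      _ ≤ Cm * ν * J := by
          have : 0 ≤ ν * J := mul_nonneg hν.le hJ
          nlinarith
      _ = J / 2 * (2 * Cm * ν) := by ring
  have hclaim : ∀ s : unitInterval, s ≤ tI → J / 2 ≤ C s := by
    intro s hs
    have hs' : (s : ℝ) ≤ t₀ := hs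
    have hsF : (s : ℝ) * F ≤ t₀ * F := mul_le_mul_of_nonneg_right hs' hF
    have := hT s
    linarith
  have hDt := hD tI (J / 2) hclaim
  have hNt := hN tI
  have htI : ((tI : unitInterval) : ℝ) = t₀ := rfl
  -- the gain
  have hgain : κ * c₁ / (4 * Cm) * (τA * τB) ≤ κ * t₀ * (J / 2) := by
    have e : κ * t₀ * (J / 2) = (κ * τA * J) / (4 * Cm * ν) := by
      rw [ht₀]; field_simp; ring
    rw [e, le_div_iff₀ (by positivity)]
    have e2 : κ * c₁ / (4 * Cm) * (τA * τB) * (4 * Cm * ν) = κ * τA * (c₁ * ν * τB) := by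
      field_simp
    rw [e2]
    exact mul_le_mul_of_nonneg_left h1 (by positivity)
  calc (1 + κ * c₁ / (4 * Cm)) * τA * τB = τA * τB + κ * c₁ / (4 * Cm) * (τA * τB) := by ring
    _ ≤ φ tI + κ * (tI : ℝ) * (J / 2) := add_le_add hNt (by rw [htI]; exact hgain)
    _ ≤ PAB := by linarith

/-- **The line concludes the crux BY NAME** from the five registered stubs; no `sorry` of its own. -/
theorem TetrahedronHarrisGap_of :
    Summit.CriticalPhenomena.PercolationContinuityZ3.Theses.PercTreeValue.TetrahedronHarrisGap := by
  obtain ⟨κ, hκ, hD⟩ := stub_noiseWindow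
  obtain ⟨c₁, hc₁, r₁, h1⟩ := stub_bridgeMass
  obtain ⟨C₂, hC₂, r₂, h2⟩ := stub_bridgeFragility
  refine ⟨κ * c₁ / (4 * max C₂ 1), by positivity, max r₁ r₂, fun r hr => ?_⟩
  obtain ⟨hJ, hν⟩ := h1 r (le_of_max_le_left hr)
  have hF2 := h2 r (le_of_max_le_right hr)
  exact harrisGap_of_noiseData hκ hc₁ hC₂ (stub_noiseHarris r) (hD r) (stub_noiseStability r) hJ hν hF2
    (Finset.sum_nonneg fun _ _ => Finset.sum_nonneg fun _ _ => measureReal_nonneg)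
    (tau_nonneg _ _ _) (tau_nonneg _ _ _) measureReal_nonneg

end Summit.CriticalPhenomena.PercolationContinuityZ3.Cruxes.TetrahedronHarrisGap.NoiseBridges

end
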